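import Summits.QuantumFields.QCD.Theses.SpectralDefectExtinction
import Literature.Analysis.Matrix.QuadraticCombesThomas

/-!
# Stub `stub_agmonOuterFloor` of line `block-away-the-sign`
(crux `Summit.QuantumFields.QCD.Theses.SpectralDefectExtinction.ExtinctionBuildsQCD`,
item stmt-QuantumFields-18064; stub W2 of the sparse-window-wells module)

**Operator Agmon estimate from an OUTER floor (eigen-equation trick, absolute constant).**
Let `dist` be an `ℕ`-valued pseudo-distance on a finite index set `ι`, `A : Matrix ι ι ℂ` of range
one (`A i j ≠ 0 → dist i j ≤ 1`) with absolute row and column sums over `{dist ≠ 0}` at most `h`,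
`ρ : ι → ℕ` `1`-Lipschitz for `dist`, and assume the OUTER FLOOR: for every `|λ| ≤ E₀`,
`g² Σ|v_i|² ≤ Σ|((A − λ)v)_i|²` whenever `v` vanishes on `{ρ < r₀}`, with `g > 0`.  Then every
eigenvector `Aψ = λψ`, `|λ| ≤ E₀`, satisfies, for every rate `κ ≥ 0` with `h(e^κ − 1) ≤ g/4` and
every `d : ℕ`,
`Σ_{ρ i ≥ r₀ + d} |ψ_i|² ≤ 100 · e^{−2κd} · Σ_i |ψ_i|²` (`stub_agmonOuterFloor`).

Proof (Agmon / Combes–Thomas weighted-commutator method, finite-dimensional).  If `κ = 0` the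
bound is trivial.  Otherwise put `ε := e^κ − 1 ≥ κ > 0`, `r₁ := ⌊1/ε⌋ + 1` (so `h/r₁ ≤ hε ≤ g/4`
and `κ(r₁ − 1) ≤ κ/ε ≤ 1`), the ramp `η(x) = max 0 (min 1 ((x − r₀ + 1)/r₁))` (`= 0` for
`x ≤ r₀ − 1`, `= 1` for `x ≥ r₀ + r₁ − 1`, `(1/r₁)`-Lipschitz; `agmonRamp_exists`), the weights
`W_i := η(ρ_i) e^{κρ_i}` and `f := Wψ`, which vanishes on `{ρ < r₀}`.  By the eigen-equation,
`((A − λ)f)_i = Σ_j A_ij (W_j − W_i) ψ_j = (E₂ψ)_i − (E₁f)_i` with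
`(E₁)_ij = A_ij (e^{κ(ρ_i − ρ_j)} − 1)` and `(E₂)_ij = A_ij (η(ρ_j) − η(ρ_i)) e^{κρ_i}`; both vanish
where `dist i j = 0` (then `ρ_i = ρ_j`), `|E₁|_ij ≤ ε|A_ij|`
(`Literature.Analysis.Matrix.norm_mul_exp_sub_one_le`) and `|E₂|_ij ≤ (M/r₁)|A_ij|` with
`M = e^{κ(r₀ + r₁ − 1)}` (the ramp moves only where `ρ_i ≤ r₀ + r₁ − 1`).  Schur's test
(`Literature.Analysis.Matrix.sum_norm_sq_mulVec_le_of_rowSum_le_of_colSum_le`) gives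
`‖E₁f‖ ≤ εh‖f‖ ≤ (g/4)‖f‖` and `‖E₂ψ‖ ≤ (Mh/r₁)‖ψ‖ ≤ (Mg/4)‖ψ‖`, so the floor yields
`g²‖f‖² ≤ 2(g/4)²‖f‖² + 2(Mg/4)²‖ψ‖²`, i.e. `7‖f‖² ≤ M²‖ψ‖²` (`agmon_core`).  For `d + 1 ≥ r₁` the
ramp equals `1` on `{ρ ≥ r₀ + d}`, whence
`Σ_{ρ ≥ r₀+d}|ψ|² ≤ e^{−2κ(r₀+d)}‖f‖² ≤ (e^{2κ(r₁−1)}/7) e^{−2κd}‖ψ‖² ≤ (e²/7) e^{−2κd}‖ψ‖²`; for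
`d + 1 < r₁` one has `κd ≤ 1`, so `100 e^{−2κd} ≥ 100/e² ≥ 1`.  Only the commutator `[A, W]`
enters, never `‖A‖/g`.

References (method): Agmon, *Lectures on exponential decay* (1982); Combes–Thomas, Comm. Math.
Phys. 34 (1973) 251; Aizenman–Warzel, GSM 168, §10.3.
-/

noncomputable section

namespace Summit.QuantumFields.QCD.Cruxes.ExtinctionBuildsQCD.BlockAwayTheSign

open scoped BigOperators Topology Classical MeasureTheory Matrix
open Filter MeasureTheory Matrix

/-! ### Elementary helpers -/

/-- **The Agmon ramp.** For `r₁ > 0` there is `η : ℝ → [0, 1]` with `η = 0` on `(−∞, r₀ − 1]`,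
`η = 1` on `[r₀ + r₁ − 1, ∞)`, and `|η x − η y| ≤ |x − y|/r₁`; explicitly
`η x = max 0 (min 1 ((x − r₀ + 1)/r₁))`. [folklore] -/
theorem agmonRamp_exists (r₀ r₁ : ℝ) (hr₁ : 0 < r₁) :
    ∃ η : ℝ → ℝ, (∀ x, 0 ≤ η x) ∧ (∀ x, η x ≤ 1) ∧ (∀ x, x ≤ r₀ - 1 → η x = 0) ∧
      (∀ x, r₀ + r₁ - 1 ≤ x → η x = 1) ∧ (∀ x y, |η x - η y| ≤ |x - y| / r₁) := by
  refine ⟨fun x => max 0 (min 1 ((x - r₀ + 1) / r₁)), fun x => le_max_left _ _,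
    fun x => max_le zero_le_one (min_le_left _ _), fun x hx => ?_, fun x hx => ?_, fun x y => ?_⟩
  · have h1 : (x - r₀ + 1) / r₁ ≤ 0 := div_nonpos_of_nonpos_of_nonneg (by linarith) hr₁.le
    exact max_eq_left ((min_le_right _ _).trans h1)
  · have h1 : 1 ≤ (x - r₀ + 1) / r₁ := by rw [le_div_iff₀ hr₁]; linarith
    show max 0 (min 1 ((x - r₀ + 1) / r₁)) = 1
    rw [min_eq_left h1, max_eq_right zero_le_one]
  · calc |max 0 (min 1 ((x - r₀ + 1) / r₁)) - max 0 (min 1 ((y - r₀ + 1) / r₁))|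
        ≤ |min 1 ((x - r₀ + 1) / r₁) - min 1 ((y - r₀ + 1) / r₁)| := by
          rw [max_comm 0, max_comm 0]; exact abs_max_sub_max_le_abs _ _ _
      _ ≤ |(x - r₀ + 1) / r₁ - (y - r₀ + 1) / r₁| :=
          (abs_min_sub_min_le_max _ _ _ _).trans (max_le (by simp) le_rfl)
      _ = |x - y| / r₁ := by
          rw [← sub_div, abs_div, abs_of_pos hr₁]
          congr 2; ring

/-- A function `ρ : ι → ℕ` that is `1`-Lipschitz for a symmetric `ℕ`-valued `dist` in the one-sided
integer form `ρ i − ρ j ≤ dist i j` satisfies `|ρ i − ρ j| ≤ dist i j` over `ℝ`. [folklore] -/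
theorem abs_natCast_rho_sub_le {ι : Type*} (dist : ι → ι → ℕ) (hds : ∀ i j, dist i j = dist j i)
    (ρ : ι → ℕ) (hLip : ∀ i j, (ρ i : ℤ) - ρ j ≤ dist i j) (i j : ι) :
    |(ρ i : ℝ) - ρ j| ≤ dist i j := by
  have h1 := (Int.cast_le (R := ℝ)).mpr (hLip i j)
  have h2 := (Int.cast_le (R := ℝ)).mpr (hLip j i)
  push_cast at h1 h2
  rw [hds j i] at h2
  rw [abs_le]
  constructor <;> linarith

/-- Off-diagonal domination: if `f₁ k ≤ c · 𝟙[nz k] f₂ k` pointwise with `c ≥ 0` and the `f₂`-sum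
over `{nz}` is at most `b`, then `Σ_k f₁ k ≤ c b`. [folklore] -/
theorem sum_le_mul_of_le_ite {ι : Type*} [Fintype ι] (f₁ f₂ : ι → ℝ) (nz : ι → Prop)
    [DecidablePred nz] {c b : ℝ} (hc : 0 ≤ c) (hf : ∀ k, f₁ k ≤ c * (if nz k then f₂ k else 0))
    (hb : ∑ k ∈ Finset.univ.filter nz, f₂ k ≤ b) : ∑ k, f₁ k ≤ c * b :=
  calc ∑ k, f₁ k ≤ ∑ k, c * (if nz k then f₂ k else 0) := Finset.sum_le_sum fun k _ => hf k
    _ = c * ∑ k ∈ Finset.univ.filter nz, f₂ k := by rw [← Finset.mul_sum, Finset.sum_filter]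
    _ ≤ c * b := mul_le_mul_of_nonneg_left hb hc

/-- `e² < 9`. [folklore] -/
theorem exp_two_lt_nine : Real.exp 2 < 9 := by
  have h1 := Real.exp_one_lt_d9
  have h2 := Real.exp_pos 1
  rw [show (2 : ℝ) = 1 + 1 by norm_num, Real.exp_add]
  nlinarith

/-! ### The Agmon core: weighted mass bound from the outer floor -/

/-- **Agmon core estimate.**  Under the hypotheses of `stub_agmonOuterFloor` at a fixed `λ` (range
one, off-diagonal row/column sums `≤ h` with `h ≥ 0`, `ρ` Lipschitz, the floor for vectors vanishing
on `{ρ < r₀}`, `κ ≥ 0`, `h(e^κ − 1) ≤ g/4`, `Aψ = λψ`) and for a ramp width `r₁ ≥ 1` with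
`h/r₁ ≤ g/4`: for every `d` with `d + 1 ≥ r₁`,
`Σ_{ρ i ≥ r₀ + d} |ψ_i|² ≤ (e^{2κ(r₁ − 1)}/7) · e^{−2κd} · Σ_i |ψ_i|²`.
(Weights `W_i = η(ρ_i) e^{κρ_i}` with the ramp `η` of `agmonRamp_exists`, the commutator identity
`(A − λ)(Wψ) = E₂ψ − E₁(Wψ)`, Schur's test for `E₁, E₂`, and the floor.) [folklore] -/
theorem agmon_core {ι : Type*} [Fintype ι] [DecidableEq ι] (dist : ι → ι → ℕ)
    (hds : ∀ i j, dist i j = dist j i) (A : Matrix ι ι ℂ)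
    (hrange : ∀ i j, A i j ≠ 0 → dist i j ≤ 1) (h : ℝ) (hh : 0 ≤ h)
    (hrow : ∀ i, ∑ j ∈ Finset.univ.filter (fun j => dist i j ≠ 0), ‖A i j‖ ≤ h)
    (hcol : ∀ j, ∑ i ∈ Finset.univ.filter (fun i => dist i j ≠ 0), ‖A i j‖ ≤ h)
    (ρ : ι → ℕ) (hLip : ∀ i j, (ρ i : ℤ) - ρ j ≤ dist i j) (g : ℝ) (hg : 0 < g) (r₀ : ℕ)
    (lam : ℝ) (hfloor : ∀ v : ι → ℂ, (∀ i, ρ i < r₀ → v i = 0) →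
      g ^ 2 * ∑ i, ‖v i‖ ^ 2 ≤ ∑ i, ‖((A - (lam : ℂ) • (1 : Matrix ι ι ℂ)) *ᵥ v) i‖ ^ 2)
    (κ : ℝ) (hκ : 0 ≤ κ) (hrate : h * (Real.exp κ - 1) ≤ g / 4)
    (r₁ : ℕ) (hr₁ : 1 ≤ r₁) (hr₁h : h / r₁ ≤ g / 4)
    (ψ : ι → ℂ) (heig : A *ᵥ ψ = (lam : ℂ) • ψ) (d : ℕ) (hd : r₁ ≤ d + 1) :
    ∑ i ∈ Finset.univ.filter (fun i => r₀ + d ≤ ρ i), ‖ψ i‖ ^ 2 ≤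
      Real.exp (2 * κ * ((r₁ : ℝ) - 1)) / 7 * Real.exp (-(2 * κ * (d : ℝ))) * ∑ i, ‖ψ i‖ ^ 2 := by
  have hr₁pos : (0 : ℝ) < r₁ := by exact_mod_cast hr₁
  obtain ⟨η, -, -, hηlo, hηhi, hηLip⟩ := agmonRamp_exists (r₀ : ℝ) (r₁ : ℝ) hr₁pos
  -- the weights `W i = η(ρ i) e^{κ ρ i}`, the weighted eigenvector `f = W ψ`, and the constants
  set e : ι → ℝ := fun i => Real.exp (κ * ρ i) with he
  set W : ι → ℝ := fun i => η (ρ i) * e i with hW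
  set f : ι → ℂ := fun i => (W i : ℂ) * ψ i with hf
  set M : ℝ := Real.exp (κ * ((r₀ : ℝ) + r₁ - 1)) with hM
  set ε : ℝ := Real.exp κ - 1 with hε
  have hε0 : 0 ≤ ε := by have := Real.add_one_le_exp κ; rw [hε]; linarith
  -- the two perturbations: `(A - λ) f = E₂ ψ - E₁ f`
  set E₁ : Matrix ι ι ℂ := Matrix.of fun i j =>
    A i j * ((Real.exp (κ * ((ρ i : ℝ) - ρ j)) - 1 : ℝ) : ℂ) with hE₁
  set E₂ : Matrix ι ι ℂ := Matrix.of fun i j =>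
    A i j * (((η (ρ j) - η (ρ i)) * e i : ℝ) : ℂ) with hE₂
  -- (1) `f` vanishes on `{ρ < r₀}`
  have hfvan : ∀ i, ρ i < r₀ → f i = 0 := by
    intro i hi
    have h1 : (ρ i : ℝ) ≤ r₀ - 1 := by
      have h2 : ((ρ i + 1 : ℕ) : ℝ) ≤ r₀ := by exact_mod_cast hi
      push_cast at h2
      linarith
    simp [hf, hW, hηlo _ h1]
  -- (2) the eigen-equation trick: `((A - λ) f)_i = Σ_j A_ij (W_j - W_i) ψ_j = (E₂ ψ)_i - (E₁ f)_i`
  have heig_i : ∀ i, ∑ j, A i j * ψ j = (lam : ℂ) * ψ i := fun i => by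
    simpa [Matrix.mulVec, dotProduct] using congrFun heig i
  have hident : ∀ i, ((A - (lam : ℂ) • (1 : Matrix ι ι ℂ)) *ᵥ f) i =
      (E₂ *ᵥ ψ) i - (E₁ *ᵥ f) i := by
    intro i
    rw [Matrix.sub_mulVec, Matrix.smul_mulVec, Matrix.one_mulVec, Pi.sub_apply, Pi.smul_apply,
      smul_eq_mul]
    have hLHS : (A *ᵥ f) i - (lam : ℂ) * f i = ∑ j, A i j * (((W j : ℂ) - W i) * ψ j) := by
      simp only [Matrix.mulVec, dotProduct, hf]
      rw [show (lam : ℂ) * ((W i : ℂ) * ψ i) = (W i : ℂ) * ((lam : ℂ) * ψ i) by ring, ← heig_i i,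
        Finset.mul_sum, ← Finset.sum_sub_distrib]
      exact Finset.sum_congr rfl fun j _ => by ring
    have hRHS : (E₂ *ᵥ ψ) i - (E₁ *ᵥ f) i = ∑ j, A i j * (((W j : ℂ) - W i) * ψ j) := by
      simp only [Matrix.mulVec, dotProduct, hE₁, hE₂, Matrix.of_apply, hf, hW]
      rw [← Finset.sum_sub_distrib]
      refine Finset.sum_congr rfl fun j _ => ?_
      have hc : Real.exp (κ * ((ρ i : ℝ) - ρ j)) * e j = e i := by
        simp only [he]; rw [← Real.exp_add]; ring_nf
      have hc' : ((Real.exp (κ * ((ρ i : ℝ) - ρ j)) : ℝ) : ℂ) * (e j : ℂ) = (e i : ℂ) := by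
        exact_mod_cast hc
      simp only [Complex.ofReal_sub, Complex.ofReal_mul, Complex.ofReal_one]
      linear_combination (-(A i j * ψ j * (η (ρ j) : ℂ))) * hc'
    rw [hLHS, hRHS]
  -- (3) entry bounds: `|E₁_ij| ≤ ε|A_ij|`, `|E₂_ij| ≤ (M/r₁)|A_ij|`, both zero where `dist = 0`
  have hρ : ∀ i j, |(ρ i : ℝ) - ρ j| ≤ dist i j := abs_natCast_rho_sub_le dist hds ρ hLip
  have hE₁_le : ∀ i j, ‖E₁ i j‖ ≤ ε * (if dist i j ≠ 0 then ‖A i j‖ else 0) := fun i j => by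
    simp only [hE₁, Matrix.of_apply]
    exact Literature.Analysis.Matrix.norm_mul_exp_sub_one_le dist A hrange hκ i j (hρ i j)
  have hMr : 0 ≤ M / r₁ := by positivity
  have hE₂_le : ∀ i j, ‖E₂ i j‖ ≤ M / r₁ * (if dist i j ≠ 0 then ‖A i j‖ else 0) := fun i j => by
    have hR : 0 ≤ M / r₁ * (if dist i j ≠ 0 then ‖A i j‖ else 0) :=
      mul_nonneg hMr (by split_ifs <;> simp)
    simp only [hE₂, Matrix.of_apply]
    by_cases hA : A i j = 0
    · simp [hA]
    have hd1 : (dist i j : ℝ) ≤ 1 := by exact_mod_cast hrange i j hA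
    have hρ1 : |(ρ i : ℝ) - ρ j| ≤ 1 := (hρ i j).trans hd1
    by_cases hd0 : dist i j = 0
    · have h0 := hρ i j
      rw [hd0, Nat.cast_zero] at h0
      have : (ρ i : ℝ) = ρ j := sub_eq_zero.mp (abs_nonpos_iff.mp h0)
      simp [this, hd0]
    rw [if_pos hd0, norm_mul, Complex.norm_real, Real.norm_eq_abs, mul_comm]
    refine mul_le_mul_of_nonneg_right ?_ (norm_nonneg _)
    rw [abs_mul, abs_of_pos (Real.exp_pos _)]
    by_cases hi : (ρ i : ℝ) ≤ r₀ + r₁ - 1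
    · -- inside the ramp zone: `|η(ρ j) - η(ρ i)| ≤ 1/r₁` and `e^{κ ρ i} ≤ M`
      have h1 : |η (ρ j) - η (ρ i)| ≤ 1 / r₁ := by
        refine (hηLip _ _).trans ?_
        rw [abs_sub_comm] at hρ1
        gcongr
      have h2 : e i ≤ M := Real.exp_le_exp.mpr (mul_le_mul_of_nonneg_left hi hκ)
      calc |η (ρ j) - η (ρ i)| * e i ≤ (1 / r₁) * M :=
            mul_le_mul h1 h2 (Real.exp_pos _).le (by positivity)
        _ = M / r₁ := by ring
    · -- beyond the ramp: `ρ i ≥ r₀ + r₁`, `ρ j ≥ r₀ + r₁ - 1`, both ramps equal `1`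
      push Not at hi
      have h3 : r₀ + r₁ < ρ i + 1 := by
        have : (r₀ : ℝ) + r₁ < ρ i + 1 := by linarith
        exact_mod_cast this
      have h4 : (r₀ : ℝ) + r₁ ≤ ρ i := by exact_mod_cast Nat.lt_succ_iff.mp h3
      have h5 : (r₀ : ℝ) + r₁ - 1 ≤ ρ j := by linarith [(abs_le.mp hρ1).1, (abs_le.mp hρ1).2]
      rw [hηhi _ hi.le, hηhi _ h5, sub_self, abs_zero, zero_mul]
      exact hMr
  -- (4) Schur's test for both perturbations
  have hS₁ : ∑ i, ‖(E₁ *ᵥ f) i‖ ^ 2 ≤ (ε * h) * (ε * h) * ∑ i, ‖f i‖ ^ 2 :=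
    Literature.Analysis.Matrix.sum_norm_sq_mulVec_le_of_rowSum_le_of_colSum_le E₁
      (mul_nonneg hε0 hh)
      (fun i => sum_le_mul_of_le_ite _ _ _ hε0 (fun j => hE₁_le i j) (hrow i))
      (fun j => sum_le_mul_of_le_ite (fun i => ‖E₁ i j‖) (fun i => ‖A i j‖)
        (fun i => dist i j ≠ 0) hε0 (fun i => hE₁_le i j) (hcol j)) f
  have hS₂ : ∑ i, ‖(E₂ *ᵥ ψ) i‖ ^ 2 ≤ (M / r₁ * h) * (M / r₁ * h) * ∑ i, ‖ψ i‖ ^ 2 :=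
    Literature.Analysis.Matrix.sum_norm_sq_mulVec_le_of_rowSum_le_of_colSum_le E₂
      (mul_nonneg hMr hh)
      (fun i => sum_le_mul_of_le_ite _ _ _ hMr (fun j => hE₂_le i j) (hrow i))
      (fun j => sum_le_mul_of_le_ite (fun i => ‖E₂ i j‖) (fun i => ‖A i j‖)
        (fun i => dist i j ≠ 0) hMr (fun i => hE₂_le i j) (hcol j)) ψ
  -- (5) the floor: `g² ‖f‖² ≤ ‖(A-λ)f‖² ≤ 2(g/4)² ‖f‖² + 2(Mg/4)² ‖ψ‖²`, so `7 ‖f‖² ≤ M² ‖ψ‖²`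
  set Sf : ℝ := ∑ i, ‖f i‖ ^ 2 with hSf
  set T : ℝ := ∑ i, ‖ψ i‖ ^ 2 with hT
  have hT0 : 0 ≤ T := Finset.sum_nonneg fun i _ => by positivity
  have hSf0 : 0 ≤ Sf := Finset.sum_nonneg fun i _ => by positivity
  have hpt : ∀ i, ‖((A - (lam : ℂ) • (1 : Matrix ι ι ℂ)) *ᵥ f) i‖ ^ 2 ≤
      2 * ‖(E₁ *ᵥ f) i‖ ^ 2 + 2 * ‖(E₂ *ᵥ ψ) i‖ ^ 2 := by
    intro i
    rw [hident i]
    have h1 := norm_sub_le ((E₂ *ᵥ ψ) i) ((E₁ *ᵥ f) i)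
    have h2 := norm_nonneg ((E₂ *ᵥ ψ) i - (E₁ *ᵥ f) i)
    nlinarith [sq_nonneg (‖(E₂ *ᵥ ψ) i‖ - ‖(E₁ *ᵥ f) i‖), norm_nonneg ((E₂ *ᵥ ψ) i),
      norm_nonneg ((E₁ *ᵥ f) i)]
  have hfl : g ^ 2 * Sf ≤
      2 * ((ε * h) * (ε * h) * Sf) + 2 * ((M / r₁ * h) * (M / r₁ * h) * T) := by
    calc g ^ 2 * Sf ≤ ∑ i, ‖((A - (lam : ℂ) • (1 : Matrix ι ι ℂ)) *ᵥ f) i‖ ^ 2 := hfloor f hfvan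
      _ ≤ ∑ i, (2 * ‖(E₁ *ᵥ f) i‖ ^ 2 + 2 * ‖(E₂ *ᵥ ψ) i‖ ^ 2) :=
          Finset.sum_le_sum fun i _ => hpt i
      _ = 2 * ∑ i, ‖(E₁ *ᵥ f) i‖ ^ 2 + 2 * ∑ i, ‖(E₂ *ᵥ ψ) i‖ ^ 2 := by
          rw [Finset.sum_add_distrib, Finset.mul_sum, Finset.mul_sum]
      _ ≤ _ := by linarith [hS₁, hS₂]
  have hεh : ε * h ≤ g / 4 := by rw [mul_comm]; exact hrate
  have hMh : M / r₁ * h ≤ M * (g / 4) := by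
    rw [div_mul_eq_mul_div, mul_div_assoc]
    exact mul_le_mul_of_nonneg_left hr₁h (Real.exp_pos _).le
  have hεh0 : 0 ≤ ε * h := mul_nonneg hε0 hh
  have hMh0 : 0 ≤ M / r₁ * h := mul_nonneg hMr hh
  have h7 : 7 * Sf ≤ M ^ 2 * T := by
    have h1 : (ε * h) * (ε * h) * Sf ≤ (g / 4) * (g / 4) * Sf :=
      mul_le_mul_of_nonneg_right (mul_le_mul hεh hεh hεh0 (by positivity)) hSf0
    have h2 : (M / r₁ * h) * (M / r₁ * h) * T ≤ (M * (g / 4)) * (M * (g / 4)) * T :=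
      mul_le_mul_of_nonneg_right (mul_le_mul hMh hMh hMh0 (by positivity)) hT0
    have h3 : g ^ 2 * (7 * Sf) ≤ g ^ 2 * (M ^ 2 * T) := by nlinarith
    exact le_of_mul_le_mul_left h3 (by positivity)
  -- (6) on `{ρ ≥ r₀ + d}` (`d + 1 ≥ r₁`) the ramp is `1`: `|ψ_i|² ≤ e^{-2κ(r₀+d)} |f_i|²`
  have hkey : ∀ i ∈ Finset.univ.filter (fun i => r₀ + d ≤ ρ i),
      ‖ψ i‖ ^ 2 ≤ Real.exp (-(2 * κ * ((r₀ : ℝ) + d))) * ‖f i‖ ^ 2 := by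
    intro i hi
    rw [Finset.mem_filter] at hi
    have h1 : (r₀ : ℝ) + d ≤ ρ i := by exact_mod_cast hi.2
    have h2 : (r₀ : ℝ) + r₁ - 1 ≤ ρ i := by
      have : (r₁ : ℝ) ≤ d + 1 := by exact_mod_cast hd
      linarith
    have h3 : W i = e i := by simp only [hW, hηhi _ h2, one_mul]
    have h4 : ‖f i‖ ^ 2 = e i ^ 2 * ‖ψ i‖ ^ 2 := by
      simp only [hf]
      rw [norm_mul, Complex.norm_real, Real.norm_eq_abs, h3, abs_of_pos (Real.exp_pos _), mul_pow]
    have h5 : 1 ≤ Real.exp (-(2 * κ * ((r₀ : ℝ) + d))) * e i ^ 2 := by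
      simp only [he]
      rw [pow_two, ← Real.exp_add, ← Real.exp_add]
      refine Real.one_le_exp ?_
      nlinarith [mul_le_mul_of_nonneg_left h1 hκ]
    rw [h4, ← mul_assoc]
    nlinarith [norm_nonneg (ψ i), sq_nonneg ‖ψ i‖]
  have hexp : Real.exp (-(2 * κ * ((r₀ : ℝ) + d))) * M ^ 2 =
      Real.exp (2 * κ * ((r₁ : ℝ) - 1)) * Real.exp (-(2 * κ * (d : ℝ))) := by
    simp only [hM]
    rw [pow_two, ← Real.exp_add, ← Real.exp_add, ← Real.exp_add]
    congr 1; ring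
  calc ∑ i ∈ Finset.univ.filter (fun i => r₀ + d ≤ ρ i), ‖ψ i‖ ^ 2
      ≤ ∑ i ∈ Finset.univ.filter (fun i => r₀ + d ≤ ρ i),
          Real.exp (-(2 * κ * ((r₀ : ℝ) + d))) * ‖f i‖ ^ 2 := Finset.sum_le_sum hkey
    _ = Real.exp (-(2 * κ * ((r₀ : ℝ) + d))) *
          ∑ i ∈ Finset.univ.filter (fun i => r₀ + d ≤ ρ i), ‖f i‖ ^ 2 := by rw [Finset.mul_sum]
    _ ≤ Real.exp (-(2 * κ * ((r₀ : ℝ) + d))) * Sf :=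
        mul_le_mul_of_nonneg_left (Finset.sum_le_univ_sum_of_nonneg fun i => by positivity)
          (Real.exp_pos _).le
    _ ≤ Real.exp (-(2 * κ * ((r₀ : ℝ) + d))) * (M ^ 2 / 7 * T) :=
        mul_le_mul_of_nonneg_left (by linarith) (Real.exp_pos _).le
    _ = Real.exp (2 * κ * ((r₁ : ℝ) - 1)) / 7 * Real.exp (-(2 * κ * (d : ℝ))) * T := by
        rw [← mul_assoc, mul_div_assoc', hexp]; ring

/-! ### The stub -/

/-- **Stub W2 (`stub_agmonOuterFloor`) — operator Agmon estimate from an OUTER floor (eigen-equation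
trick, absolute constant).** `A` has off-site range one for the `ℕ`-valued pseudo-distance `dist`,
off-diagonal row and column sums `≤ h`; `ρ` is `1`-Lipschitz for `dist` (think `ρ = dist(·, R)`, `R`
the well set); OUTER FLOOR: for every `|λ| ≤ E₀`, `g²‖v‖² ≤ ‖(A − λ)v‖²` whenever `v` vanishes on
`{ρ < r₀}`.  Then every eigenvector `Aψ = λψ` with `|λ| ≤ E₀` has at most `100 e^{−2κd}` of its
`ℓ²` mass on `{ρ ≥ r₀ + d}`, for any rate `κ ≥ 0` with `h(e^κ − 1) ≤ g/4`.  Agmon–Combes–Thomas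
weighted-commutator method with a ramp cutoff of width `⌊1/(e^κ − 1)⌋ + 1` (`agmon_core`); only
`[A, W]ψ` enters, never `‖A‖/g`; the case `κ = 0` and the short distances `κ d ≤ 1` are trivial
(`e² < 9`). [folklore] -/
theorem stub_agmonOuterFloor :
    ∀ {ι : Type} [Fintype ι] [DecidableEq ι] (dist : ι → ι → ℕ), (∀ i, dist i i = 0) → (∀ i j, dist
    i j = dist j i) → (∀ i j l, dist i l ≤ dist i j + dist j l) → ∀ (A : Matrix ι ι ℂ), (∀ i j, A i
    j ≠ 0 → dist i j ≤ 1) → ∀ (h : ℝ), (∀ i, ∑ j ∈ Finset.univ.filter (fun j => dist i j ≠ 0), ‖A i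
    j‖ ≤ h) → (∀ j, ∑ i ∈ Finset.univ.filter (fun i => dist i j ≠ 0), ‖A i j‖ ≤ h) → ∀ (ρ : ι → ℕ),
    (∀ i j, (ρ i : ℤ) - ρ j ≤ dist i j) → ∀ (E₀ g : ℝ), 0 < g → ∀ (r₀ : ℕ), (∀ lam : ℝ, |lam| ≤ E₀ →
    ∀ v : ι → ℂ, (∀ i, ρ i < r₀ → v i = 0) → g ^ 2 * ∑ i, ‖v i‖ ^ 2 ≤ ∑ i, ‖((A - (lam : ℂ) • (1 :
    Matrix ι ι ℂ)) *ᵥ v) i‖ ^ 2) → ∀ (κ : ℝ), 0 ≤ κ → h * (Real.exp κ - 1) ≤ g / 4 → ∀ (lam : ℝ) (ψ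
    : ι → ℂ), |lam| ≤ E₀ → A *ᵥ ψ = (lam : ℂ) • ψ → ∀ d : ℕ, ∑ i ∈ Finset.univ.filter (fun i => r₀ +
    d ≤ ρ i), ‖ψ i‖ ^ 2 ≤ 100 * Real.exp (-(2 * κ * (d : ℝ))) * ∑ i, ‖ψ i‖ ^ 2 := by
  intro ι _ _ dist _hd0 hds _hdt A hrange h hrow hcol ρ hLip E₀ g hg r₀ hfloor κ hκ hrate lam ψ hlam
    heig d
  have hT0 : 0 ≤ ∑ i, ‖ψ i‖ ^ 2 := Finset.sum_nonneg fun i _ => by positivity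
  have hSd : ∑ i ∈ Finset.univ.filter (fun i => r₀ + d ≤ ρ i), ‖ψ i‖ ^ 2 ≤ ∑ i, ‖ψ i‖ ^ 2 :=
    Finset.sum_le_univ_sum_of_nonneg fun i => by positivity
  have h9 := exp_two_lt_nine
  -- the trivial regime `2κd ≤ 2`: the tail is at most the total mass, and `100 e^{-2κd} ≥ 1`
  have htriv : 2 * κ * d ≤ 2 → ∑ i ∈ Finset.univ.filter (fun i => r₀ + d ≤ ρ i), ‖ψ i‖ ^ 2 ≤
      100 * Real.exp (-(2 * κ * (d : ℝ))) * ∑ i, ‖ψ i‖ ^ 2 := fun hle => by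
    have h1 : Real.exp (-2) ≤ Real.exp (-(2 * κ * d)) := Real.exp_le_exp.mpr (by linarith)
    have h2 : Real.exp (-2) * Real.exp 2 = 1 := by rw [← Real.exp_add]; norm_num
    have h3 : 1 ≤ 100 * Real.exp (-(2 * κ * (d : ℝ))) := by nlinarith [Real.exp_pos (-2)]
    nlinarith
  rcases hκ.eq_or_lt with hκ0 | hκpos
  · exact htriv (by rw [← hκ0]; norm_num)
  rcases isEmpty_or_nonempty ι with hι | ⟨⟨i₀⟩⟩
  · simp
  have hh : 0 ≤ h := (Finset.sum_nonneg fun j _ => norm_nonneg _).trans (hrow i₀)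
  -- the ramp width `r₁ = ⌊1/(e^κ - 1)⌋ + 1`: `h/r₁ ≤ h(e^κ - 1) ≤ g/4` and `κ(r₁ - 1) ≤ 1`
  set ε : ℝ := Real.exp κ - 1 with hε
  have hκε : κ ≤ ε := by have := Real.add_one_le_exp κ; rw [hε]; linarith
  have hεpos : 0 < ε := hκpos.trans_le hκε
  set r₁ : ℕ := ⌊1 / ε⌋₊ + 1 with hr₁
  have hr₁1 : 1 ≤ r₁ := Nat.le_add_left 1 _
  have hflo : ((⌊1 / ε⌋₊ : ℕ) : ℝ) ≤ 1 / ε := Nat.floor_le (by positivity)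
  have hr₁gt : 1 / ε < (r₁ : ℝ) := by rw [hr₁]; push_cast; exact Nat.lt_floor_add_one _
  have hκx : ∀ x : ℝ, x ≤ 1 / ε → κ * x ≤ 1 := fun x hx =>
    calc κ * x ≤ κ * (1 / ε) := mul_le_mul_of_nonneg_left hx hκ
      _ = κ / ε := mul_one_div κ ε
      _ ≤ 1 := div_le_one_of_le₀ hκε hεpos.le
  have hr₁h : h / r₁ ≤ g / 4 := by
    have h1 : 1 / (r₁ : ℝ) ≤ ε := by
      rw [div_le_iff₀ (by positivity)]
      exact ((div_lt_iff₀ hεpos).mp hr₁gt).le.trans_eq (mul_comm _ _)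
    calc h / r₁ = h * (1 / r₁) := by ring
      _ ≤ h * ε := mul_le_mul_of_nonneg_left h1 hh
      _ ≤ g / 4 := hrate
  by_cases hd : r₁ ≤ d + 1
  · -- the Agmon regime `d + 1 ≥ r₁`
    have hcore := agmon_core dist hds A hrange h hh hrow hcol ρ hLip g hg r₀ lam (hfloor lam hlam)
      κ hκ hrate r₁ hr₁1 hr₁h ψ heig d hd
    have h1 : κ * ((r₁ : ℝ) - 1) ≤ 1 := hκx _ (by rw [hr₁]; push_cast; linarith)
    have h2 : Real.exp (2 * κ * ((r₁ : ℝ) - 1)) ≤ 9 :=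
      (Real.exp_le_exp.mpr (by linarith)).trans h9.le
    refine hcore.trans ?_
    have h3 : 0 ≤ Real.exp (-(2 * κ * (d : ℝ))) * ∑ i, ‖ψ i‖ ^ 2 := by positivity
    calc Real.exp (2 * κ * ((r₁ : ℝ) - 1)) / 7 * Real.exp (-(2 * κ * (d : ℝ))) * ∑ i, ‖ψ i‖ ^ 2
        = Real.exp (2 * κ * ((r₁ : ℝ) - 1)) / 7 *
            (Real.exp (-(2 * κ * (d : ℝ))) * ∑ i, ‖ψ i‖ ^ 2) := by ring
      _ ≤ 100 * (Real.exp (-(2 * κ * (d : ℝ))) * ∑ i, ‖ψ i‖ ^ 2) :=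
          mul_le_mul_of_nonneg_right (by linarith) h3
      _ = _ := by ring
  · -- short distances `d + 1 < r₁`: then `κ d ≤ κ (d + 1) ≤ 1`
    push Not at hd
    refine htriv ?_
    have h1 : (d : ℝ) + 1 ≤ 1 / ε := by
      have h2 : d + 1 ≤ ⌊1 / ε⌋₊ := by omega
      calc (d : ℝ) + 1 = ((d + 1 : ℕ) : ℝ) := by push_cast; ring
        _ ≤ ⌊1 / ε⌋₊ := by exact_mod_cast h2
        _ ≤ 1 / ε := hflo
    have h3 := hκx _ h1
    nlinarith

end Summit.QuantumFields.QCD.Cruxes.ExtinctionBuildsQCD.BlockAwayTheSign
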